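import Literature.Geometry.Kaehler.ComplexTorusHodgeGroupProductAlmostQSimpleFactor
import Literature.Geometry.Kaehler.ComplexTorusLefschetzGroupReductive
import Literature.Geometry.Kaehler.ComplexTorusHodgeGroupProductIrreducible
import Literature.NumberTheory.Automorphic.LieAlgebraGLFieldAut
import Literature.FieldTheory.AlgClosed.AutStableSubspaceDescent
import HarnessLib

/-!
# The Goursat kernels `K₁`, `K₂` of `Hg(X₁ × X₂)` are algebraic `ℚ`-subgroups of `Hg(X₁)`, `Hg(X₂)`; «`Hg(X₂)` almost
# `ℚ`-simple» as a statement about algebraic `ℚ`-SUBGROUPS (Zariski-closed and `Aut(ℂ)`-stable) is EQUIVALENT to the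
# Lie-algebra rendering; Moonen–Zarhin's Lemma (3.6) ∕ (3.4) dichotomy for such a factor, at the group level

Layer `Literature/Geometry/Kaehler`, namespace `Literature.Geometry.Kaehler.ComplexTorus`; lane `lit-hodgefound` (Track 2
foundations library), Layer A3/A4; prover seat `lit-hodgefound-p17` (generation 43, self-proposed row g43-#2, the GROUP-LEVEL
companion of g43-#1 `ComplexTorusHodgeGroupProductAlmostQSimpleFactor`).  THEOREMS ONLY (no definition, no instance, no
notation, no named fact; D-0026 net debt 0).

THE LANE'S DICTIONARY «algebraic group defined over `ℚ`» (p40 `ComplexTorusHodgeGroupConjugates`, p22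
`ComplexTorusMumfordTateGroupDefinedOverQ`): a subgroup `N ≤ SL(V_ℂ) = SL_ι(ℂ)` which is ZARISKI-CLOSED (`IsZariskiClosed`)
and `Aut(ℂ)`-STABLE (`IsAutStable`) — by Galois descent `ℂ/ℚ` (the converse of Imai's sentence, p40
`isRatAlgSubgroupEqs_ratVanishing` ∕ `complexPoints_ratVanishing_eq`; p22 `isDefinedOver_rat_iff_isAutStableGL`) exactly the
groups of complex points of families of rational subgroup equations, and exactly the algebraic subgroups with `IsDefinedOver ℚ`
in the linear-algebraic-groups library.  In this dictionary Moonen–Zarhin's hypothesis of Lemma (3.6) «`Hg(X₂)` is a `ℚ`-simple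
algebraic torus» ∕ of Lemma (3.4) «`𝔥𝔤(X₂)` is `ℚ`-simple» is, through what their proofs use, the CLASSICAL

  `(hQ′)` «`Hg(X₂)` ALMOST `ℚ`-SIMPLE»: every Zariski-closed, `Aut(ℂ)`-stable `N ≤ Hg(X₂)(ℂ)` normalised by `Hg(X₂)(ℂ)` is
  FINITE or `Hg(X₂)(ℂ)` (Milne Def. 19.7 with «defined over `ℚ`»; for a torus: no non-trivial proper `ℚ`-subtorus),

and their mechanism «`𝔤₁` and `𝔤₃` are algebraic Lie subalgebras of `𝔥𝔤(X)`» is: THE GOURSAT KERNELS `K₁ = {s | (s 0; 0 1) ∈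
Hg(X₁ × X₂)(ℂ)}`, `K₂ = {t | (1 0; 0 t) ∈ Hg(X₁ × X₂)(ℂ)}` ARE ALGEBRAIC `ℚ`-SUBGROUPS (§2: Zariski-closed by block substitution of
the equations of `Hg(X₁ × X₂)(ℂ)`; `Aut(ℂ)`-stable since `σ(1 0; 0 t) = (1 0; 0 σt)`; Springer 12.1: kernels of `F`-homomorphisms
are `F`-subgroups).  Hence (§4) under `(hQ′)`: `K₂` is finite or `K₂ = Hg(X₂)(ℂ)` — IN ONE LINE, at the group level — i.e.
`𝔥𝔤(X) ≅ 𝔥𝔤(X₁)`, `𝔥𝔤(X₂) ≅ 𝔤₃` or `Hg(X₁ × X₂) = Hg(X₁) × Hg(X₂)`.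

THE TWO RENDERINGS AGREE (§3).  g43-#1 rendered the hypothesis on LIE ALGEBRAS: `(hQ)` «every Zariski-connected `M ≤ Hg(X₂)(ℂ)`
normalised by `Hg(X₂)(ℂ)` whose Lie algebra is spanned by its rational points is `{e}` or `Hg(X₂)(ℂ)`».  We prove
`(hQ′) ⟺ (hQ)` for EVERY complex torus, from two general facts about subgroups `M ≤ GL(V)(ℂ)` proved in §1 (Springer 11.1.4,
12.1.2; Borel AG 14): (a) if `M` is `Aut(ℂ)`-stable then `Lie M` IS DEFINED OVER `ℚ` — it is the complex span of its rational
points (`Lie(σM) = σ Lie(M)`, LAG `coe_lieAlgebraGL_map`, and the tree's descent of `Aut(ℂ)`-stable subspaces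
`Complex.submodule_le_span_fixed_of_forall_ringEquiv`); (b) if `M` is Zariski-connected and `Lie M` is defined over `ℚ` then `M`
is `Aut(ℂ)`-stable (`σM` is Zariski-connected with the same Lie algebra; Tauvel–Yu 24.3.5).  With p40's identity component
`N^{so}` (Zariski-closed, `Aut(ℂ)`-stable, of finite index, `= identityComponent` in `GL`: p40 ∕ p22 ∕ `ComplexTorusLefschetzGroupReductive`)
this gives `(hQ) ⟹ (hQ′)`, and the `SL`-trace of a connected `M` gives `(hQ′) ⟹ (hQ)`.  A third rendering `(hQ″)`, in the
currency of `hodgeGroupC` itself (families of RATIONAL subgroup equations `Q` and their complex points `V_ℂ(Q) ∩ SL`), agrees with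
both (p40's descent `complexPoints_ratVanishing_eq`).  Consequently every result of g43-#1 holds under `(hQ′)` ∕ `(hQ″)` (feed
`forall_eq_bot_or_eq_of_almostRatSimple Φ₂ hQ'` for its hypothesis `hQ`), and `(hQ′)` holds for `𝒜(X₂)` a `ℚ`-simple Lie
algebra, for `dim_ℚ 𝒜(X₂) = 1`, and for `ℂ`-almost-simple `Hg(X₂)(ℂ)` (§3).

## Sources, verbatim

* B. Moonen, Yu. G. Zarhin [MoonenZarhin1999LowDim], Math. Ann. 315 (1999), §3 Lemma (3.6) and proof (arXiv v2 = Math. Ann. numbering; the ℚ-simple-Lie-algebra lemma is (3.4) — earlier tree copies of this family wrote «Lemma (3.5)», which is Borovoi’s Remark) (held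
  `paper:arxiv-math_9901113` p0007 L13–L25): «Assume that the Hodge group `Hg(X₂)` is a `ℚ`-simple algebraic torus. […] If
  `Hg(X) ≠ Hg(X₁) × Hg(X₂)` then the center of `Hg(X₁)` contains an algebraic torus which is `ℚ`-isogenous to `Hg(X₂)`. […] The
  assumption that `Hg(X₂)` is `ℚ`-simple implies that `𝔥𝔤(X₂)` does not contain a proper algebraic Lie subalgebra. Using the
  notations of (3.1) we then have that `𝔥𝔤(X) = 𝔤₁ ⊕ 𝔤₃ ≅ 𝔥𝔤(X₁)` and `𝔥𝔤(X₂) ≅ 𝔤₃`. This readily implies the lemma, noting that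
  `𝔤₁` and `𝔤₃` are algebraic Lie subalgebras of `𝔥𝔤(X)`.»; Lemma (3.4), proof; §3 (3.1).
* T. A. Springer [Springer1998], *Linear Algebraic Groups*, 2nd ed.: 11.1.4 («A subspace `W` of `V` is defined over `F` if and
  only if `Γ.W = W`»), 11.2.8 (i), 12.1.1 («`G⁰` is an `F`-subgroup»), 12.1.2 (the Lie algebra of an `F`-group is defined over
  `F`), 2.2.1, 4.4.5–4.4.7, 1.8.2.
* A. Borel [Borel1991], *Linear Algebraic Groups*, 2nd ed., AG §14.1–14.3 (`k`-structures; `V^{Aut(K/k)}`), I.3.5.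
* H. Imai [Imai1976HodgeGroups], Kōdai Math. Sem. Rep. 27 (1976), §2 (p. 368): «As `H` is defined over `Q`, `h^σ ∈ H` for all
  `h ∈ H` and for all `σ ∈ Aut(C)`.»
* J. S. Milne [Milne2017], *Algebraic Groups*, Def. 19.7 (almost-simple), Prop. 6.10.  G. Malle, D. Testerman
  [MalleTesterman2011], Thm. 7.9 (b).  P. Tauvel, R. W. T. Yu [TauvelYu2005], 24.3.5.  B. B. Gordon [Gordon1997], §2.16.
  P. Deligne [Deligne1982HodgeCycles], I §3 Prop. 3.4.

## What is proved

* §1 (`M ≤ GL_ι(ℂ)` arbitrary) **`coe_lieAlgebraGL_eq_span_ratCast_of_forall_map_mem`** (`M` `Aut(ℂ)`-stable ⟹ `Lie M` is the complex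
  span of its rational points — «`Lie` of an `F`-group is defined over `F`»), `map_mem_lieAlgebraGL_of_forall_map_mem`,
  **`map_generalLinearGroup_eq_of_isZConnected_of_coe_lieAlgebraGL_eq_span`** (`M` Zariski-connected with `Lie M` defined over `ℚ`
  ⟹ `σ(M) = M` for every `σ ∈ Aut(ℂ)`).
* §2 **`isZariskiClosed_hodgeGroupCProdInr`** ∕ `…Inl`, **`isAutStable_hodgeGroupCProdInr`** ∕ `…Inl`,
  `isRatAlgSubgroupEqs_ratVanishing_hodgeGroupCProdInr` + `complexPoints_ratVanishing_hodgeGroupCProdInr` (`K₂` is the group of complex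
  points of its own RATIONAL equations) ∕ `…Inl`, `exists_isRatAlgSubgroupEqs_forall_mem_hodgeGroupCProdInr_iff` ∕ `…Inl` (some family
  of rational subgroup equations cuts out exactly `K₂`, `K₁`), `isAutStableGL_map_toGL_hodgeGroupCProdInr`,
  **`isDefinedOver_rat_map_toGL_hodgeGroupCProdInr`** ∕ `…Inl` (`K₂`, `K₁` are `IsDefinedOver ℚ` in the LAG library).
* §3 (every complex torus `X`) **`forall_eq_bot_or_eq_of_almostRatSimple`** (`(hQ′) ⟹ (hQ)`),
  **`forall_finite_or_eq_of_almostQSimple`** (`(hQ) ⟹ (hQ′)`), **`almostRatSimple_iff_almostQSimple`**,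
  `forall_complexPoints_finite_or_eq_iff_almostRatSimple` (`(hQ″) ⟺ (hQ′)`), `forall_complexPoints_finite_or_eq_iff_almostQSimple`
  (`(hQ″) ⟺ (hQ)`); sources of `(hQ′)`: `forall_finite_or_eq_of_isSimple_hodgeGroupLieRat`,
  `forall_finite_or_eq_of_finrank_hodgeGroupLieRat_eq_one`, `forall_finite_or_eq_of_almostSimple`.
* §4 (products) **`finite_hodgeGroupCProdInr_or_eq_of_almostRatSimple`** (`K₂` finite ∨ `K₂ = Hg(X₂)(ℂ)`, directly from §2), the
  mirror `finite_hodgeGroupCProdInl_or_eq_of_almostRatSimple`, and for BOTH factors almost `ℚ`-simple and `Hg(X₁ × X₂) ≠ Hg(X₁) × Hg(X₂)`: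
  `finite_hodgeGroupCProdInl_and_finite_hodgeGroupCProdInr_of_ne_of_almostRatSimple` (both kernels finite),
  `nonempty_lieEquiv_hodgeGroupLieRat_prod_and_of_ne_of_almostRatSimple` (`𝒜(X) ≃ₗ⁅ℚ⁆ 𝒜(X₁)`, `𝒜(X) ≃ₗ⁅ℚ⁆ 𝒜(X₂)`, `𝒜(X₁) ≃ₗ⁅ℚ⁆ 𝒜(X₂)`).

NOT here: «`ℚ`-isogenous» for the central torus of Lemma (3.6) as a statement on character groups; Ribet's Lemma (3.7); Prop. (3.8).
-/

noncomputable section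

open Matrix Module Function
open scoped Cardinal

namespace Literature.Geometry.Kaehler

namespace ComplexTorus

open Literature.NumberTheory.Automorphic (IsAlgebraicSubgroup IsZConnected identityComponent isZConnected_identityComponent
  identityComponent_le lieAlgebraGL lieAlgebraGL_mono isAlgebraicSubgroup_bot map_conj_identityComponent_eq
  map_conj_eq_self_of_forall_conj_mem glMapEquiv isZariskiAut_glMapEquiv subgroup_map_map_symm map_mem_lieAlgebraGL_map
  IsDefinedOver)

/-! ### §0 Plumbing (file-local) -/

section Plumbing

/-- The prime field `ℚ ⊆ ℂ` is countable. [folklore] -/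
private theorem cardinalMk_fieldRange_ratCast_le₄₃ : #((Rat.castHom ℂ).fieldRange) ≤ ℵ₀ := by
  rw [Cardinal.mk_le_aleph0_iff]
  exact (Set.countable_range (Rat.castHom ℂ)).to_subtype

variable {ι : Type*} [Fintype ι] [DecidableEq ι]

omit [Fintype ι] [DecidableEq ι] in
/-- `σ` fixes rational matrices: `σ(A ⊗ 1) = A ⊗ 1`. [folklore] -/
private theorem map_ratCast_map_ringEquiv (σ : ℂ ≃+* ℂ) (A : Matrix ι ι ℚ) :
    (A.map ((↑) : ℚ → ℂ)).map σ = A.map ((↑) : ℚ → ℂ) := by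
  ext i j
  simp [Matrix.map_apply]

omit [Fintype ι] [DecidableEq ι] in
/-- The complex span of a set of rational matrices is stable under the entrywise action of `Aut(ℂ)` (semilinearity).
[cite: Springer1998, §11.1.3 ("`Γ` operates on `V = k ⊗_F V(F)` by `γ(a ⊗ v) = (γ.a) ⊗ v`")] -/
private theorem map_ringEquiv_mem_span_image_ratCast (σ : ℂ ≃+* ℂ) (R : Set (Matrix ι ι ℚ)) {Z : Matrix ι ι ℂ}
    (hZ : Z ∈ Submodule.span ℂ ((fun A : Matrix ι ι ℚ ↦ A.map ((↑) : ℚ → ℂ)) '' R)) :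
    Z.map σ ∈ Submodule.span ℂ ((fun A : Matrix ι ι ℚ ↦ A.map ((↑) : ℚ → ℂ)) '' R) := by
  induction hZ using Submodule.span_induction with
  | mem Y hY =>
    obtain ⟨A, hA, rfl⟩ := hY
    rw [map_ratCast_map_ringEquiv]
    exact Submodule.subset_span ⟨A, hA, rfl⟩
  | zero =>
    rw [Matrix.map_zero _ (map_zero σ)]
    exact zero_mem _
  | add Y Y' _ _ hY hY' =>
    rw [Matrix.map_add _ (map_add σ)]
    exact add_mem hY hY'
  | smul c Y _ hY =>
    have h : (c • Y).map (σ : ℂ → ℂ) = σ c • Y.map σ := by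
      ext i j
      simp [Matrix.map_apply]
    rw [h]
    exact Submodule.smul_mem _ _ hY

/-- `σ(σ⁻¹ g) = g` on `GL_ι(ℂ)`. [folklore] -/
private theorem generalLinearGroup_map_map_symm₄₃ (σ : ℂ ≃+* ℂ) (g : GL ι ℂ) :
    Matrix.GeneralLinearGroup.map (σ : ℂ →+* ℂ) (Matrix.GeneralLinearGroup.map (σ.symm : ℂ →+* ℂ) g) = g :=
  Units.ext <| by ext i j; simp

/-- `σ(M) = M` for all `σ` as soon as `σ(M) ⊆ M` for all `σ`. [folklore] -/
private theorem map_generalLinearGroup_eq_of_forall_map_mem {M : Subgroup (GL ι ℂ)}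
    (hstab : ∀ (σ : ℂ ≃+* ℂ) (g : GL ι ℂ), g ∈ M → Matrix.GeneralLinearGroup.map (σ : ℂ →+* ℂ) g ∈ M) (σ : ℂ ≃+* ℂ) :
    M.map (Matrix.GeneralLinearGroup.map (σ : ℂ →+* ℂ)) = M := by
  refine le_antisymm ?_ fun g hg ↦ ?_
  · rintro _ ⟨g, hg, rfl⟩
    exact hstab σ g hg
  · exact ⟨Matrix.GeneralLinearGroup.map (σ.symm : ℂ →+* ℂ) g, hstab σ.symm g hg, generalLinearGroup_map_map_symm₄₃ σ g⟩

end Plumbing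

/-! ### §1 Descent for Lie algebras: `Aut(ℂ)`-stable `M ≤ GL(V)(ℂ)` have Lie algebras defined over `ℚ`, and conversely for
connected `M` -/

section Descent

variable {ι : Type*} [Fintype ι] [DecidableEq ι] {M : Subgroup (GL ι ℂ)}

/-- `Lie M` is `Aut(ℂ)`-stable for `Aut(ℂ)`-stable `M` (`Lie(σM) = σ Lie(M)`). [cite: Borel1991, I.3.5 and AG §14] -/
theorem map_mem_lieAlgebraGL_of_forall_map_mem
    (hstab : ∀ (σ : ℂ ≃+* ℂ) (g : GL ι ℂ), g ∈ M → Matrix.GeneralLinearGroup.map (σ : ℂ →+* ℂ) g ∈ M)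
    (σ : ℂ ≃+* ℂ) {A : Matrix ι ι ℂ} (hA : A ∈ lieAlgebraGL M) : A.map σ ∈ lieAlgebraGL M := by
  have h := map_mem_lieAlgebraGL_map σ hA
  rwa [map_generalLinearGroup_eq_of_forall_map_mem hstab σ] at h

/-- **THE LIE ALGEBRA OF AN `Aut(ℂ)`-STABLE SUBGROUP OF `GL(V)(ℂ)` IS DEFINED OVER `ℚ`**: it is the complex span of its rational
points `{A ∈ M_ι(ℚ) | A ⊗ 1 ∈ Lie M}` («the Lie algebra of an `F`-group is defined over `F`»; Galois descent for the
`Aut(ℂ)`-stable subspace `Lie M ⊆ 𝔤𝔩_ι(ℂ)`, `ℂ^{Aut(ℂ)} = ℚ`). [cite: Springer1998, 11.1.4 and 12.1.2] [cite: Borel1991, AG §14.2 and I.3.5] -/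
theorem coe_lieAlgebraGL_eq_span_ratCast_of_forall_map_mem
    (hstab : ∀ (σ : ℂ ≃+* ℂ) (g : GL ι ℂ), g ∈ M → Matrix.GeneralLinearGroup.map (σ : ℂ →+* ℂ) g ∈ M) :
    (lieAlgebraGL M : Set (Matrix ι ι ℂ)) = Submodule.span ℂ ((fun A : Matrix ι ι ℚ ↦ A.map ((↑) : ℚ → ℂ)) ''
      {A : Matrix ι ι ℚ | A.map ((↑) : ℚ → ℂ) ∈ lieAlgebraGL M}) := by
  classical
  -- transport `M_ι(ℂ) ≅ ℂ^{ι × ι}`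
  let φ : Matrix ι ι ℂ →ₗ[ℂ] (ι × ι → ℂ) :=
    { toFun := fun A p ↦ A p.1 p.2
      map_add' := fun _ _ ↦ rfl
      map_smul' := fun _ _ ↦ rfl }
  let ψ : (ι × ι → ℂ) →ₗ[ℂ] Matrix ι ι ℂ :=
    { toFun := fun w ↦ Matrix.of fun i j ↦ w (i, j)
      map_add' := fun _ _ ↦ rfl
      map_smul' := fun _ _ ↦ rfl }
  have hψφ : ∀ A : Matrix ι ι ℂ, ψ (φ A) = A := fun A ↦ by ext i j; rfl
  -- the transported subspace is `Aut(ℂ)`-stable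
  let V : Submodule ℂ (ι × ι → ℂ) := (lieAlgebraGL M).map φ
  have hV : ∀ ρ : ℂ ≃+* ℂ, (∀ x ∈ (Rat.castHom ℂ).fieldRange, ρ x = x) → ∀ v ∈ V, (⇑ρ ∘ v) ∈ V := by
    intro ρ _ v hv
    obtain ⟨A, hA, rfl⟩ := hv
    exact ⟨A.map ρ, map_mem_lieAlgebraGL_of_forall_map_mem hstab ρ hA, funext fun p ↦ rfl⟩
  have hle := Literature.FieldTheory.AlgClosed.Complex.submodule_le_span_fixed_of_forall_ringEquiv _
    cardinalMk_fieldRange_ratCast_le₄₃ V hV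
  refine Set.Subset.antisymm (fun Z hZ ↦ ?_) (SetLike.coe_subset_coe.2 (Submodule.span_le.2 ?_))
  · have hφZ : φ Z ∈ V := Submodule.mem_map_of_mem hZ
    have h1 : ψ (φ Z) ∈ Submodule.span ℂ (ψ '' {w : ι × ι → ℂ | w ∈ V ∧ ∀ i, w i ∈ (Rat.castHom ℂ).fieldRange}) := by
      rw [Submodule.span_image]
      exact Submodule.mem_map_of_mem (hle hφZ)
    rw [hψφ] at h1
    refine (Submodule.span_mono ?_) h1
    rintro _ ⟨w, ⟨hwV, hwrat⟩, rfl⟩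
    obtain ⟨A, hA, rfl⟩ := hwV
    rw [hψφ]
    choose q hq using fun p : ι × ι ↦ RingHom.mem_fieldRange.1 (hwrat p)
    have e : (Matrix.of fun i j ↦ q (i, j)).map ((↑) : ℚ → ℂ) = A := by
      ext i j
      exact hq (i, j)
    refine ⟨Matrix.of fun i j ↦ q (i, j), ?_, e⟩
    change (Matrix.of fun i j ↦ q (i, j)).map ((↑) : ℚ → ℂ) ∈ lieAlgebraGL M
    rw [e]
    exact hA
  · rintro _ ⟨A, hA, rfl⟩
    exact hA

/-- **A ZARISKI-CONNECTED `M ≤ GL(V)(ℂ)` WHOSE LIE ALGEBRA IS DEFINED OVER `ℚ` IS `Aut(ℂ)`-STABLE**: `σ(M)` is Zariski-connected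
with `Lie σ(M) = σ(Lie M) = Lie M` (the complex span of rational matrices is `σ`-stable), and Zariski-connected subgroups with the
same Lie algebra coincide. [cite: Springer1998, 11.1.4 and 11.2.8 (i)] [cite: TauvelYu2005, 24.3.5 (ii)] [cite: Borel1991, AG §14] -/
theorem map_generalLinearGroup_eq_of_isZConnected_of_coe_lieAlgebraGL_eq_span (hM : IsZConnected M)
    (hdef : (lieAlgebraGL M : Set (Matrix ι ι ℂ)) = Submodule.span ℂ ((fun A : Matrix ι ι ℚ ↦ A.map ((↑) : ℚ → ℂ)) ''
      {A : Matrix ι ι ℚ | A.map ((↑) : ℚ → ℂ) ∈ lieAlgebraGL M})) (σ : ℂ ≃+* ℂ) :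
    M.map (Matrix.GeneralLinearGroup.map (σ : ℂ →+* ℂ)) = M := by
  set R : Set (Matrix ι ι ℚ) := {A : Matrix ι ι ℚ | A.map ((↑) : ℚ → ℂ) ∈ lieAlgebraGL M} with hR
  -- `Lie M` is `τ`-stable for every `τ`
  have hstabLie : ∀ (τ : ℂ ≃+* ℂ) {Z : Matrix ι ι ℂ}, Z ∈ lieAlgebraGL M → Z.map τ ∈ lieAlgebraGL M := by
    intro τ Z hZ
    have hZ' : Z ∈ (lieAlgebraGL M : Set (Matrix ι ι ℂ)) := hZ
    rw [hdef, SetLike.mem_coe] at hZ'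
    have h := map_ringEquiv_mem_span_image_ratCast τ R hZ'
    rw [← SetLike.mem_coe, ← hdef] at h
    exact h
  have hσM : IsZConnected (M.map (Matrix.GeneralLinearGroup.map (σ : ℂ →+* ℂ))) :=
    (isZariskiAut_glMapEquiv σ).isZConnected_map hM
  refine hσM.eq_of_lieAlgebraGL_eq hM (SetLike.coe_injective ?_)
  rw [Literature.NumberTheory.Automorphic.coe_lieAlgebraGL_map]
  refine Set.Subset.antisymm ?_ fun Z hZ ↦ ?_
  · rintro _ ⟨Z, hZ, rfl⟩
    exact hstabLie σ hZ
  · refine ⟨Z.map σ.symm, hstabLie σ.symm hZ, ?_⟩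
    ext i j
    simp [Matrix.map_apply]

end Descent

/-! ### §2 `K₂`, `K₁` are algebraic `ℚ`-subgroups of `Hg(X₂)(ℂ)`, `Hg(X₁)(ℂ)` -/

section Kernels

variable {ι₁ ι₂ : Type*} [Fintype ι₁] [Fintype ι₂] [DecidableEq ι₁] [DecidableEq ι₂]
  {E₁ E₂ : Type*} [NormedAddCommGroup E₁] [NormedSpace ℂ E₁] [NormedAddCommGroup E₂] [NormedSpace ℂ E₂]
  (Φ₁ : (ι₁ → ℝ) ≃L[ℝ] E₁) (Φ₂ : (ι₂ → ℝ) ≃L[ℝ] E₂)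

/-- **`K₂ = {t | (1 0; 0 t) ∈ Hg(X₁ × X₂)(ℂ)}` IS ZARISKI-CLOSED in `SL(V₂ ⊗ ℂ)`**: substitute `(1 0; 0 x)` in the equations of
`Hg(X₁ × X₂)(ℂ)`. [cite: Springer1998, 2.2.5 (i) and 12.1.1] [cite: MoonenZarhin1999LowDim, §3 Lemma (3.6), proof ("algebraic Lie subalgebras")] -/
theorem isZariskiClosed_hodgeGroupCProdInr : IsZariskiClosed (hodgeGroupCProdInr Φ₁ Φ₂) := by
  obtain ⟨T, hT⟩ := (isZariskiClosed_hodgeGroupC (prodPeriod Φ₁ Φ₂)).exists_forall_mem_iff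
  refine ⟨⟨rightBlockSubst (1 : Matrix ι₁ ι₁ ℂ) '' T, fun t ↦ ?_⟩⟩
  rw [mem_hodgeGroupCProdInr_iff, hT, Set.forall_mem_image]
  refine forall₂_congr fun F _ ↦ ?_
  rw [evalMatC_rightBlockSubst, coe_blockDiagC]
  rfl

/-- **`K₁ = {s | (s 0; 0 1) ∈ Hg(X₁ × X₂)(ℂ)}` IS ZARISKI-CLOSED in `SL(V₁ ⊗ ℂ)`.** [cite: Springer1998, 2.2.5 (i) and 12.1.1]
[cite: MoonenZarhin1999LowDim, §3 Lemma (3.6), proof] -/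
theorem isZariskiClosed_hodgeGroupCProdInl : IsZariskiClosed (hodgeGroupCProdInl Φ₁ Φ₂) := by
  obtain ⟨T, hT⟩ := (isZariskiClosed_hodgeGroupC (prodPeriod Φ₁ Φ₂)).exists_forall_mem_iff
  refine ⟨⟨leftBlockSubst (1 : Matrix ι₂ ι₂ ℂ) '' T, fun s ↦ ?_⟩⟩
  rw [mem_hodgeGroupCProdInl_iff, hT, Set.forall_mem_image]
  refine forall₂_congr fun F _ ↦ ?_
  rw [evalMatC_leftBlockSubst, coe_blockDiagC]
  rfl

/-- **`K₂` IS `Aut(ℂ)`-STABLE**: `σ(1 0; 0 t) = (1 0; 0 σt)` and `Hg(X₁ × X₂)(ℂ)` is `Aut(ℂ)`-stable («as `H` is defined over `Q`,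
`h^σ ∈ H`»). [cite: Imai1976HodgeGroups, §2 (p. 368)] [cite: Springer1998, 12.1.1] -/
theorem isAutStable_hodgeGroupCProdInr : IsAutStable (hodgeGroupCProdInr Φ₁ Φ₂) :=
  ⟨fun σ t ht ↦ by
    rw [mem_hodgeGroupCProdInr_iff] at ht ⊢
    have h := (isAutStable_hodgeGroupC (prodPeriod Φ₁ Φ₂)).map_mem σ _ ht
    rwa [map_blockDiagC, map_one] at h⟩

/-- **`K₁` IS `Aut(ℂ)`-STABLE.** [cite: Imai1976HodgeGroups, §2 (p. 368)] [cite: Springer1998, 12.1.1] -/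
theorem isAutStable_hodgeGroupCProdInl : IsAutStable (hodgeGroupCProdInl Φ₁ Φ₂) :=
  ⟨fun σ s hs ↦ by
    rw [mem_hodgeGroupCProdInl_iff] at hs ⊢
    have h := (isAutStable_hodgeGroupC (prodPeriod Φ₁ Φ₂)).map_mem σ _ hs
    rwa [map_blockDiagC, map_one] at h⟩

/-- **`K₂` IS AN ALGEBRAIC `ℚ`-GROUP**: its rational equations `ratVanishing K₂` are a family of `ℚ`-subgroup equations …
[cite: Springer1998, 12.1.1 and 11.2.8 (i)] [cite: Deligne1982HodgeCycles, I §3 Prop. 3.4 (proof)] -/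
theorem isRatAlgSubgroupEqs_ratVanishing_hodgeGroupCProdInr : IsRatAlgSubgroupEqs (ratVanishing (hodgeGroupCProdInr Φ₁ Φ₂)) :=
  isRatAlgSubgroupEqs_ratVanishing (isZariskiClosed_hodgeGroupCProdInr Φ₁ Φ₂) (isAutStable_hodgeGroupCProdInr Φ₁ Φ₂)

/-- … whose complex points are exactly `K₂` («`𝔤₂`, `𝔤₃` are algebraic», DEFINED OVER `ℚ`, at the group level).
[cite: MoonenZarhin1999LowDim, §3 Lemma (3.6), proof] [cite: Springer1998, 12.1.1] -/
theorem complexPoints_ratVanishing_hodgeGroupCProdInr :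
    (isRatAlgSubgroupEqs_ratVanishing_hodgeGroupCProdInr Φ₁ Φ₂).complexPoints = hodgeGroupCProdInr Φ₁ Φ₂ :=
  complexPoints_ratVanishing_eq (isZariskiClosed_hodgeGroupCProdInr Φ₁ Φ₂) (isAutStable_hodgeGroupCProdInr Φ₁ Φ₂)

/-- `K₁` is an algebraic `ℚ`-group: its rational equations are `ℚ`-subgroup equations … [cite: Springer1998, 12.1.1 and 11.2.8 (i)] -/
theorem isRatAlgSubgroupEqs_ratVanishing_hodgeGroupCProdInl : IsRatAlgSubgroupEqs (ratVanishing (hodgeGroupCProdInl Φ₁ Φ₂)) :=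
  isRatAlgSubgroupEqs_ratVanishing (isZariskiClosed_hodgeGroupCProdInl Φ₁ Φ₂) (isAutStable_hodgeGroupCProdInl Φ₁ Φ₂)

/-- … with complex points `K₁`. [cite: MoonenZarhin1999LowDim, §3 Lemma (3.6), proof] [cite: Springer1998, 12.1.1] -/
theorem complexPoints_ratVanishing_hodgeGroupCProdInl :
    (isRatAlgSubgroupEqs_ratVanishing_hodgeGroupCProdInl Φ₁ Φ₂).complexPoints = hodgeGroupCProdInl Φ₁ Φ₂ :=
  complexPoints_ratVanishing_eq (isZariskiClosed_hodgeGroupCProdInl Φ₁ Φ₂) (isAutStable_hodgeGroupCProdInl Φ₁ Φ₂)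

/-- **`K₂` IS (THE GROUP OF COMPLEX POINTS OF) AN ALGEBRAIC `ℚ`-SUBGROUP OF `SL(V₂ ⊗ ℂ)`**, in the currency of `hodgeGroupC`:
some family of rational subgroup equations cuts out exactly `K₂` inside `SL(V₂ ⊗ ℂ)`.
[cite: MoonenZarhin1999LowDim, §3 Lemma (3.6), proof] [cite: Springer1998, 12.1.1] [cite: Gordon1997, §2.2 Definition] -/
theorem exists_isRatAlgSubgroupEqs_forall_mem_hodgeGroupCProdInr_iff :
    ∃ Q : Set (MvPolynomial (ι₂ × ι₂) ℚ), IsRatAlgSubgroupEqs Q ∧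
      ∀ t : SpecialLinearGroup ι₂ ℂ, t ∈ hodgeGroupCProdInr Φ₁ Φ₂ ↔ (t : Matrix ι₂ ι₂ ℂ) ∈ ratZeroLocus ℂ Q :=
  ⟨_, isRatAlgSubgroupEqs_ratVanishing_hodgeGroupCProdInr Φ₁ Φ₂, fun t ↦ by
    rw [← (isRatAlgSubgroupEqs_ratVanishing_hodgeGroupCProdInr Φ₁ Φ₂).mem_complexPoints_iff,
      complexPoints_ratVanishing_hodgeGroupCProdInr]⟩

/-- `K₁` is the group of complex points of an algebraic `ℚ`-subgroup of `SL(V₁ ⊗ ℂ)`.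
[cite: MoonenZarhin1999LowDim, §3 Lemma (3.6), proof] [cite: Springer1998, 12.1.1] [cite: Gordon1997, §2.2 Definition] -/
theorem exists_isRatAlgSubgroupEqs_forall_mem_hodgeGroupCProdInl_iff :
    ∃ Q : Set (MvPolynomial (ι₁ × ι₁) ℚ), IsRatAlgSubgroupEqs Q ∧
      ∀ s : SpecialLinearGroup ι₁ ℂ, s ∈ hodgeGroupCProdInl Φ₁ Φ₂ ↔ (s : Matrix ι₁ ι₁ ℂ) ∈ ratZeroLocus ℂ Q :=
  ⟨_, isRatAlgSubgroupEqs_ratVanishing_hodgeGroupCProdInl Φ₁ Φ₂, fun s ↦ by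
    rw [← (isRatAlgSubgroupEqs_ratVanishing_hodgeGroupCProdInl Φ₁ Φ₂).mem_complexPoints_iff,
      complexPoints_ratVanishing_hodgeGroupCProdInl]⟩

/-- `K₂ ≤ GL(V₂ ⊗ ℂ)` is `Aut(ℂ)`-stable (the `GL` twin, through `SL → GL`). [cite: Imai1976HodgeGroups, §2 (p. 368)] -/
theorem isAutStableGL_map_toGL_hodgeGroupCProdInr :
    IsAutStableGL ((hodgeGroupCProdInr Φ₁ Φ₂).map Matrix.SpecialLinearGroup.toGL) := by
  refine ⟨fun σ g hg ↦ ?_⟩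
  obtain ⟨t, ht, rfl⟩ := hg
  exact ⟨Matrix.SpecialLinearGroup.map (σ : ℂ →+* ℂ) t, (isAutStable_hodgeGroupCProdInr Φ₁ Φ₂).map_mem σ t ht,
    toGL_specialLinearGroup_map σ t⟩

/-- `K₁ ≤ GL(V₁ ⊗ ℂ)` is `Aut(ℂ)`-stable. [cite: Imai1976HodgeGroups, §2 (p. 368)] -/
theorem isAutStableGL_map_toGL_hodgeGroupCProdInl :
    IsAutStableGL ((hodgeGroupCProdInl Φ₁ Φ₂).map Matrix.SpecialLinearGroup.toGL) := by
  refine ⟨fun σ g hg ↦ ?_⟩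
  obtain ⟨s, hs, rfl⟩ := hg
  exact ⟨Matrix.SpecialLinearGroup.map (σ : ℂ →+* ℂ) s, (isAutStable_hodgeGroupCProdInl Φ₁ Φ₂).map_mem σ s hs,
    toGL_specialLinearGroup_map σ s⟩

/-- **`K₂` IS DEFINED OVER `ℚ`** in the linear-algebraic-groups library (`IsDefinedOver ℚ`: the complex vanishing ideal is generated
by rational polynomials) — Springer 12.1: the kernel of an `F`-homomorphism (here `pr₁ : Hg(X₁ × X₂) → Hg(X₁)`) is an `F`-subgroup.
[cite: Springer1998, 12.1.1 and 11.2.8 (i)] [cite: Borel1991, AG §14] -/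
theorem isDefinedOver_rat_map_toGL_hodgeGroupCProdInr :
    IsDefinedOver ℚ (((hodgeGroupCProdInr Φ₁ Φ₂).map Matrix.SpecialLinearGroup.toGL : Subgroup (GL ι₂ ℂ)) : Set (GL ι₂ ℂ)) :=
  (isAutStableGL_map_toGL_hodgeGroupCProdInr Φ₁ Φ₂).isDefinedOver_rat

/-- **`K₁` IS DEFINED OVER `ℚ`.** [cite: Springer1998, 12.1.1 and 11.2.8 (i)] [cite: Borel1991, AG §14] -/
theorem isDefinedOver_rat_map_toGL_hodgeGroupCProdInl :
    IsDefinedOver ℚ (((hodgeGroupCProdInl Φ₁ Φ₂).map Matrix.SpecialLinearGroup.toGL : Subgroup (GL ι₁ ℂ)) : Set (GL ι₁ ℂ)) :=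
  (isAutStableGL_map_toGL_hodgeGroupCProdInl Φ₁ Φ₂).isDefinedOver_rat

end Kernels

/-! ### §3 «`Hg(X)` almost `ℚ`-simple»: the `ℚ`-subgroup rendering `(hQ′)` and the Lie-algebra rendering `(hQ)` agree -/

section Renderings

variable {ι : Type*} [Fintype ι] [DecidableEq ι] {E : Type*} [NormedAddCommGroup E] [NormedSpace ℂ E]
  (Φ : (ι → ℝ) ≃L[ℝ] E)

/-- **`(hQ′) ⟹ (hQ)`.**  If every Zariski-closed `Aut(ℂ)`-stable `N ≤ Hg(X)(ℂ)` normalised by `Hg(X)(ℂ)` is finite or `Hg(X)(ℂ)`, then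
every Zariski-connected `M ≤ Hg(X)(ℂ)` (in `GL`) normalised by `Hg(X)(ℂ)` whose Lie algebra is spanned by its rational points is
`{e}` or `Hg(X)(ℂ)`: such an `M` is `Aut(ℂ)`-stable (§1), its trace on `SL` is Zariski-closed and `Aut(ℂ)`-stable, and a finite
connected group is trivial. [cite: Springer1998, 11.1.4, 11.2.8 (i), 2.2.1] [cite: Milne2017, Def. 19.7] [cite: MoonenZarhin1999LowDim, §3 Lemma (3.6), proof] -/
theorem forall_eq_bot_or_eq_of_almostRatSimple
    (hQ' : ∀ N : Subgroup (SpecialLinearGroup ι ℂ), IsZariskiClosed N → IsAutStable N → N ≤ hodgeGroupC Φ →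
      (∀ g ∈ hodgeGroupC Φ, ∀ x ∈ N, g * x * g⁻¹ ∈ N) → (N : Set (SpecialLinearGroup ι ℂ)).Finite ∨ N = hodgeGroupC Φ) :
    ∀ M : Subgroup (GL ι ℂ), IsZConnected M → M ≤ (hodgeGroupC Φ).map Matrix.SpecialLinearGroup.toGL →
      (∀ g ∈ (hodgeGroupC Φ).map Matrix.SpecialLinearGroup.toGL, M.map (MulAut.conj g : GL ι ℂ →* GL ι ℂ) = M) →
        (lieAlgebraGL M : Set (Matrix ι ι ℂ)) = Submodule.span ℂ ((fun A : Matrix ι ι ℚ ↦ A.map ((↑) : ℚ → ℂ)) ''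
          {A : Matrix ι ι ℚ | A.map ((↑) : ℚ → ℂ) ∈ lieAlgebraGL M}) →
          M = ⊥ ∨ M = (hodgeGroupC Φ).map Matrix.SpecialLinearGroup.toGL := by
  intro M hM hle hconj hdef
  have hinj := Matrix.SpecialLinearGroup.toGL_injective (n := ι) (R := ℂ)
  have hstabM := map_generalLinearGroup_eq_of_isZConnected_of_coe_lieAlgebraGL_eq_span hM hdef
  -- the trace `N = M ∩ SL` (in fact `M ⊆ SL`)
  set N : Subgroup (SpecialLinearGroup ι ℂ) := M.comap Matrix.SpecialLinearGroup.toGL with hN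
  have hNM : N.map Matrix.SpecialLinearGroup.toGL = M := by
    refine le_antisymm (Subgroup.map_comap_le _ _) fun g hg ↦ ?_
    obtain ⟨x, -, rfl⟩ := hle hg
    exact ⟨x, hg, rfl⟩
  have hNc : IsZariskiClosed N := (IsZariskiClosedGL.of_isAlgebraicSubgroup hM.1).comap_toGL
  have hNs : IsAutStable N := IsAutStableGL.comap_toGL ⟨fun σ g hg ↦ by
    rw [← hstabM σ]
    exact Subgroup.mem_map_of_mem _ hg⟩
  have hNle : N ≤ hodgeGroupC Φ := fun x hx ↦ by
    obtain ⟨y, hy, hxy⟩ := hle hx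
    rwa [← hinj hxy]
  have hNn : ∀ g ∈ hodgeGroupC Φ, ∀ x ∈ N, g * x * g⁻¹ ∈ N := by
    intro g hg x hx
    have hx' : Matrix.SpecialLinearGroup.toGL x ∈ M := hx
    change Matrix.SpecialLinearGroup.toGL (g * x * g⁻¹) ∈ M
    rw [← hconj _ (Subgroup.mem_map_of_mem _ hg), map_mul, map_mul, map_inv]
    exact ⟨_, hx', by rw [MonoidHom.coe_coe, MulAut.conj_apply]⟩
  rcases hQ' N hNc hNs hNle hNn with hfin | hall
  · left
    have hMfin : (M : Set (GL ι ℂ)).Finite := by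
      rw [← hNM, Subgroup.coe_map]
      exact hfin.image _
    haveI : Finite M := hMfin.to_subtype
    exact (hM.2 ⊥ bot_le isAlgebraicSubgroup_bot inferInstance).symm
  · right
    rw [← hNM, hall]

/-- **`(hQ) ⟹ (hQ′)`.**  If every Zariski-connected `M ≤ Hg(X)(ℂ)` normalised by `Hg(X)(ℂ)` whose Lie algebra is spanned by its
rational points is `{e}` or `Hg(X)(ℂ)`, then every Zariski-closed `Aut(ℂ)`-stable `N ≤ Hg(X)(ℂ)` normalised by `Hg(X)(ℂ)` is finite
or `Hg(X)(ℂ)`: the identity component `N⁰` is `Aut(ℂ)`-stable («`G⁰` is an `F`-subgroup»), so its Lie algebra is defined over `ℚ`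
(§1), and `N⁰ = {e}` forces `N` finite (`[N : N⁰] < ∞`). [cite: Springer1998, 12.1.1, 12.1.2, 2.2.1] [cite: Milne2017, Prop. 6.10 and Def. 19.7]
[cite: MoonenZarhin1999LowDim, §3 Lemma (3.6), proof] -/
theorem forall_finite_or_eq_of_almostQSimple
    (hQ : ∀ M : Subgroup (GL ι ℂ), IsZConnected M → M ≤ (hodgeGroupC Φ).map Matrix.SpecialLinearGroup.toGL →
      (∀ g ∈ (hodgeGroupC Φ).map Matrix.SpecialLinearGroup.toGL, M.map (MulAut.conj g : GL ι ℂ →* GL ι ℂ) = M) →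
        (lieAlgebraGL M : Set (Matrix ι ι ℂ)) = Submodule.span ℂ ((fun A : Matrix ι ι ℚ ↦ A.map ((↑) : ℚ → ℂ)) ''
          {A : Matrix ι ι ℚ | A.map ((↑) : ℚ → ℂ) ∈ lieAlgebraGL M}) →
          M = ⊥ ∨ M = (hodgeGroupC Φ).map Matrix.SpecialLinearGroup.toGL) :
    ∀ N : Subgroup (SpecialLinearGroup ι ℂ), IsZariskiClosed N → IsAutStable N → N ≤ hodgeGroupC Φ →
      (∀ g ∈ hodgeGroupC Φ, ∀ x ∈ N, g * x * g⁻¹ ∈ N) → (N : Set (SpecialLinearGroup ι ℂ)).Finite ∨ N = hodgeGroupC Φ := by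
  intro N hNc hNs hNle hNn
  have hinj := Matrix.SpecialLinearGroup.toGL_injective (n := ι) (R := ℂ)
  have hK : IsAlgebraicSubgroup (N.map Matrix.SpecialLinearGroup.toGL) := hNc.map_toGL.isAlgebraicSubgroup
  set M : Subgroup (GL ι ℂ) := (strongIdentityComponent N).map Matrix.SpecialLinearGroup.toGL with hMdef
  have hMeq : M = identityComponent (N.map Matrix.SpecialLinearGroup.toGL) :=
    map_toGL_strongIdentityComponent_eq_identityComponent hNc
  have hM : IsZConnected M := isZConnected_map_toGL_strongIdentityComponent hNc
  have hle : M ≤ (hodgeGroupC Φ).map Matrix.SpecialLinearGroup.toGL :=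
    Subgroup.map_mono ((strongIdentityComponent_le hNc).trans hNle)
  -- `M = N⁰` is normalised by `Hg(X)(ℂ)`
  have hconj : ∀ g ∈ (hodgeGroupC Φ).map Matrix.SpecialLinearGroup.toGL, M.map (MulAut.conj g : GL ι ℂ →* GL ι ℂ) = M := by
    rintro _ ⟨g, hg, rfl⟩
    rw [hMeq]
    refine map_conj_identityComponent_eq hK (map_conj_eq_self_of_forall_conj_mem ?_ ?_)
    · rintro _ ⟨x, hx, rfl⟩
      refine ⟨g * x * g⁻¹, hNn g hg x hx, ?_⟩
      rw [map_mul, map_mul, map_inv]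
    · rintro _ ⟨x, hx, rfl⟩
      have h := hNn g⁻¹ (inv_mem hg) x hx
      rw [inv_inv] at h
      refine ⟨g⁻¹ * x * g, h, ?_⟩
      rw [map_mul, map_mul, map_inv]
  -- `M = N⁰` is `Aut(ℂ)`-stable, hence its Lie algebra is defined over `ℚ`
  have hstab : ∀ (σ : ℂ ≃+* ℂ) (g : GL ι ℂ), g ∈ M → Matrix.GeneralLinearGroup.map (σ : ℂ →+* ℂ) g ∈ M := by
    rintro σ _ ⟨x, hx, rfl⟩
    exact ⟨Matrix.SpecialLinearGroup.map (σ : ℂ →+* ℂ) x, (isAutStable_strongIdentityComponent hNs).map_mem σ x hx,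
      toGL_specialLinearGroup_map σ x⟩
  have hdef := coe_lieAlgebraGL_eq_span_ratCast_of_forall_map_mem hstab
  rcases hQ M hM hle hconj hdef with h | h
  · -- `N⁰ = {e}`: `N` is finite
    left
    have h0 : strongIdentityComponent N = ⊥ :=
      Subgroup.map_injective hinj (h.trans (Subgroup.map_bot Matrix.SpecialLinearGroup.toGL).symm)
    have hidx := relIndex_strongIdentityComponent_ne_zero hNc
    rw [h0, Subgroup.relIndex_bot_left] at hidx
    haveI : Finite N := Nat.finite_of_card_ne_zero hidx
    exact Set.toFinite _
  · -- `N⁰ = Hg(X)(ℂ)`: `N = Hg(X)(ℂ)`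
    right
    have h1 : strongIdentityComponent N = hodgeGroupC Φ := Subgroup.map_injective hinj h
    exact le_antisymm hNle (h1 ▸ strongIdentityComponent_le hNc)

/-- **THE TWO RENDERINGS OF «`Hg(X)` ALMOST `ℚ`-SIMPLE» ARE EQUIVALENT** for every complex torus `X`: (algebraic `ℚ`-subgroups:
Zariski-closed, `Aut(ℂ)`-stable, normal ⟹ finite or all) ⟺ (Zariski-connected, normal, Lie algebra defined over `ℚ` ⟹ trivial or all).
[cite: Springer1998, 11.1.4, 12.1.1, 12.1.2] [cite: Milne2017, Def. 19.7] [cite: Borel1991, AG §14] -/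
theorem almostRatSimple_iff_almostQSimple :
    (∀ N : Subgroup (SpecialLinearGroup ι ℂ), IsZariskiClosed N → IsAutStable N → N ≤ hodgeGroupC Φ →
      (∀ g ∈ hodgeGroupC Φ, ∀ x ∈ N, g * x * g⁻¹ ∈ N) → (N : Set (SpecialLinearGroup ι ℂ)).Finite ∨ N = hodgeGroupC Φ) ↔
    ∀ M : Subgroup (GL ι ℂ), IsZConnected M → M ≤ (hodgeGroupC Φ).map Matrix.SpecialLinearGroup.toGL →
      (∀ g ∈ (hodgeGroupC Φ).map Matrix.SpecialLinearGroup.toGL, M.map (MulAut.conj g : GL ι ℂ →* GL ι ℂ) = M) →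
        (lieAlgebraGL M : Set (Matrix ι ι ℂ)) = Submodule.span ℂ ((fun A : Matrix ι ι ℚ ↦ A.map ((↑) : ℚ → ℂ)) ''
          {A : Matrix ι ι ℚ | A.map ((↑) : ℚ → ℂ) ∈ lieAlgebraGL M}) →
          M = ⊥ ∨ M = (hodgeGroupC Φ).map Matrix.SpecialLinearGroup.toGL :=
  ⟨forall_eq_bot_or_eq_of_almostRatSimple Φ, forall_finite_or_eq_of_almostQSimple Φ⟩

/-- **`(hQ′)` IN THE CURRENCY OF `hodgeGroupC` ITSELF — families of RATIONAL subgroup equations and their complex points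
`V_ℂ(Q) ∩ SL(V ⊗ ℂ)`**: every Zariski-closed `Aut(ℂ)`-stable `N` is such a group of complex points (of its own rational equations,
p40's descent `complexPoints_ratVanishing_eq`), and conversely (`isZariskiClosed_complexPoints`, `isAutStable_complexPoints`); so
`(hQ′)` ⟺ `(hQ″)` «for every family `Q` of `ℚ`-subgroup equations whose complex points lie in `Hg(X)(ℂ)` and are normalised by it,
`V_ℂ(Q) ∩ SL` is finite or `Hg(X)(ℂ)`» — «no non-trivial proper normal algebraic `ℚ`-subgroup», verbatim.
[cite: Milne2017, Def. 19.7] [cite: Deligne1982HodgeCycles, I §3 Prop. 3.4 (proof)] [cite: Borel1991, AG §14.2] [cite: Gordon1997, §2.2 Definition] -/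
theorem forall_complexPoints_finite_or_eq_iff_almostRatSimple :
    (∀ (Q : Set (MvPolynomial (ι × ι) ℚ)) (hQ : IsRatAlgSubgroupEqs Q), hQ.complexPoints ≤ hodgeGroupC Φ →
      (∀ g ∈ hodgeGroupC Φ, ∀ x ∈ hQ.complexPoints, g * x * g⁻¹ ∈ hQ.complexPoints) →
        (hQ.complexPoints : Set (SpecialLinearGroup ι ℂ)).Finite ∨ hQ.complexPoints = hodgeGroupC Φ) ↔
    ∀ N : Subgroup (SpecialLinearGroup ι ℂ), IsZariskiClosed N → IsAutStable N → N ≤ hodgeGroupC Φ →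
      (∀ g ∈ hodgeGroupC Φ, ∀ x ∈ N, g * x * g⁻¹ ∈ N) → (N : Set (SpecialLinearGroup ι ℂ)).Finite ∨ N = hodgeGroupC Φ := by
  refine ⟨fun h N hNc hNs ↦ ?_, fun h Q hQ ↦ h _ (isZariskiClosed_complexPoints hQ) (isAutStable_complexPoints hQ)⟩
  have h' := h (ratVanishing N) (isRatAlgSubgroupEqs_ratVanishing hNc hNs)
  rwa [complexPoints_ratVanishing_eq hNc hNs] at h'

/-- **THE THREE RENDERINGS AGREE: `(hQ″)` ⟺ `(hQ)`** (rational equations ⟺ Lie algebras defined over `ℚ`).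
[cite: Springer1998, 11.1.4, 12.1.1, 12.1.2] [cite: Milne2017, Def. 19.7] [cite: Borel1991, AG §14] -/
theorem forall_complexPoints_finite_or_eq_iff_almostQSimple :
    (∀ (Q : Set (MvPolynomial (ι × ι) ℚ)) (hQ : IsRatAlgSubgroupEqs Q), hQ.complexPoints ≤ hodgeGroupC Φ →
      (∀ g ∈ hodgeGroupC Φ, ∀ x ∈ hQ.complexPoints, g * x * g⁻¹ ∈ hQ.complexPoints) →
        (hQ.complexPoints : Set (SpecialLinearGroup ι ℂ)).Finite ∨ hQ.complexPoints = hodgeGroupC Φ) ↔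
    ∀ M : Subgroup (GL ι ℂ), IsZConnected M → M ≤ (hodgeGroupC Φ).map Matrix.SpecialLinearGroup.toGL →
      (∀ g ∈ (hodgeGroupC Φ).map Matrix.SpecialLinearGroup.toGL, M.map (MulAut.conj g : GL ι ℂ →* GL ι ℂ) = M) →
        (lieAlgebraGL M : Set (Matrix ι ι ℂ)) = Submodule.span ℂ ((fun A : Matrix ι ι ℚ ↦ A.map ((↑) : ℚ → ℂ)) ''
          {A : Matrix ι ι ℚ | A.map ((↑) : ℚ → ℂ) ∈ lieAlgebraGL M}) →
          M = ⊥ ∨ M = (hodgeGroupC Φ).map Matrix.SpecialLinearGroup.toGL :=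
  (forall_complexPoints_finite_or_eq_iff_almostRatSimple Φ).trans (almostRatSimple_iff_almostQSimple Φ)

/-- **`𝒜(X)` a `ℚ`-SIMPLE LIE ALGEBRA ⟹ `Hg(X)` ALMOST `ℚ`-SIMPLE as a `ℚ`-group** (Borovoi's case `End⁰(X) = ℚ`; Lemma (3.4)'s hypothesis).
[cite: MoonenZarhin1999LowDim, §3 Lemma (3.4), proof, and Remark (3.5) (Borovoi)] [cite: MalleTesterman2011, Thm 7.9 (b)] [cite: Springer1998, 12.1.1] -/
theorem forall_finite_or_eq_of_isSimple_hodgeGroupLieRat [LieAlgebra.IsSimple ℚ (hodgeGroupLieRat Φ)] :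
    ∀ N : Subgroup (SpecialLinearGroup ι ℂ), IsZariskiClosed N → IsAutStable N → N ≤ hodgeGroupC Φ →
      (∀ g ∈ hodgeGroupC Φ, ∀ x ∈ N, g * x * g⁻¹ ∈ N) → (N : Set (SpecialLinearGroup ι ℂ)).Finite ∨ N = hodgeGroupC Φ :=
  forall_finite_or_eq_of_almostQSimple Φ (forall_eq_bot_or_eq_of_isSimple_hodgeGroupLieRat Φ)

/-- **`dim_ℚ 𝒜(X) = 1` ⟹ `Hg(X)` ALMOST `ℚ`-SIMPLE as a `ℚ`-group** (rank-one tori, CM elliptic curves: every proper algebraic subgroup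
is finite). [cite: MoonenZarhin1999LowDim, §3 Lemma (3.6) and Prop. (3.8)] [cite: Springer1998, 4.4.5–4.4.7, 1.8.2] -/
theorem forall_finite_or_eq_of_finrank_hodgeGroupLieRat_eq_one (h1 : finrank ℚ (hodgeGroupLieRat Φ) = 1) :
    ∀ N : Subgroup (SpecialLinearGroup ι ℂ), IsZariskiClosed N → IsAutStable N → N ≤ hodgeGroupC Φ →
      (∀ g ∈ hodgeGroupC Φ, ∀ x ∈ N, g * x * g⁻¹ ∈ N) → (N : Set (SpecialLinearGroup ι ℂ)).Finite ∨ N = hodgeGroupC Φ :=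
  forall_finite_or_eq_of_almostQSimple Φ (forall_eq_bot_or_eq_of_finrank_hodgeGroupLieRat_eq_one Φ h1)

/-- `ℂ`-almost simple ⟹ almost `ℚ`-simple as a `ℚ`-group. [cite: Milne2017, Def 19.7] [cite: Springer1998, 12.1.1 and 2.2.1] -/
theorem forall_finite_or_eq_of_almostSimple
    (hsimple : ∀ M : Subgroup (GL ι ℂ), IsZConnected M → M ≤ (hodgeGroupC Φ).map Matrix.SpecialLinearGroup.toGL →
      (∀ g ∈ (hodgeGroupC Φ).map Matrix.SpecialLinearGroup.toGL, M.map (MulAut.conj g : GL ι ℂ →* GL ι ℂ) = M) →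
        M = ⊥ ∨ M = (hodgeGroupC Φ).map Matrix.SpecialLinearGroup.toGL) :
    ∀ N : Subgroup (SpecialLinearGroup ι ℂ), IsZariskiClosed N → IsAutStable N → N ≤ hodgeGroupC Φ →
      (∀ g ∈ hodgeGroupC Φ, ∀ x ∈ N, g * x * g⁻¹ ∈ N) → (N : Set (SpecialLinearGroup ι ℂ)).Finite ∨ N = hodgeGroupC Φ :=
  forall_finite_or_eq_of_almostQSimple Φ (forall_eq_bot_or_eq_of_almostSimple Φ hsimple)

end Renderings

/-! ### §4 Products: Moonen–Zarhin's dichotomy for a factor with almost `ℚ`-simple Hodge group, at the group level -/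

section Products

variable {ι₁ ι₂ : Type*} [Fintype ι₁] [Fintype ι₂] [DecidableEq ι₁] [DecidableEq ι₂]
  {E₁ E₂ : Type*} [NormedAddCommGroup E₁] [NormedSpace ℂ E₁] [NormedAddCommGroup E₂] [NormedSpace ℂ E₂]
  (Φ₁ : (ι₁ → ℝ) ≃L[ℝ] E₁) (Φ₂ : (ι₂ → ℝ) ≃L[ℝ] E₂)

/-- **THE DICHOTOMY, AT THE GROUP LEVEL: `Hg(X₂)` almost `ℚ`-simple (as a `ℚ`-group) ⟹ `K₂` is FINITE or `K₂ = Hg(X₂)(ℂ)`** —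
`K₂` is an algebraic `ℚ`-subgroup of `Hg(X₂)(ℂ)` normalised by `Hg(X₂)(ℂ)` (§2 and p17's `conj_mem_hodgeGroupCProdInr`); this is
Moonen–Zarhin's «`𝔥𝔤(X₂)` does not contain a proper algebraic Lie subalgebra … `𝔥𝔤(X₂) ≅ 𝔤₃`» ∕ «`𝔤₃ = 0`», one line at the
group level.  (Every consequence drawn in `ComplexTorusHodgeGroupProductAlmostQSimpleFactor` under the Lie-algebra rendering
`(hQ)` follows under `(hQ′)` by feeding `forall_eq_bot_or_eq_of_almostRatSimple Φ₂ hQ'` for `hQ`.)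
[cite: MoonenZarhin1999LowDim, §3 Lemma (3.6), proof, and (3.1)] [cite: Gordon1997, §2.16 Proposition] [cite: Springer1998, 12.1.1] -/
theorem finite_hodgeGroupCProdInr_or_eq_of_almostRatSimple
    (hQ' : ∀ N : Subgroup (SpecialLinearGroup ι₂ ℂ), IsZariskiClosed N → IsAutStable N → N ≤ hodgeGroupC Φ₂ →
      (∀ g ∈ hodgeGroupC Φ₂, ∀ x ∈ N, g * x * g⁻¹ ∈ N) → (N : Set (SpecialLinearGroup ι₂ ℂ)).Finite ∨ N = hodgeGroupC Φ₂) :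
    ((hodgeGroupCProdInr Φ₁ Φ₂ : Subgroup (SpecialLinearGroup ι₂ ℂ)) : Set (SpecialLinearGroup ι₂ ℂ)).Finite ∨
      hodgeGroupCProdInr Φ₁ Φ₂ = hodgeGroupC Φ₂ :=
  hQ' _ (isZariskiClosed_hodgeGroupCProdInr Φ₁ Φ₂) (isAutStable_hodgeGroupCProdInr Φ₁ Φ₂) (hodgeGroupCProdInr_le_hodgeGroupC Φ₁ Φ₂)
    fun _ hg _ ht ↦ conj_mem_hodgeGroupCProdInr Φ₁ Φ₂ hg ht

/-- **The mirror dichotomy: `Hg(X₁)` almost `ℚ`-simple (as a `ℚ`-group) ⟹ `K₁` is finite or `K₁ = Hg(X₁)(ℂ)`.**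
[cite: MoonenZarhin1999LowDim, §3 Lemma (3.6), proof, and (3.1)] [cite: Gordon1997, §2.16 Proposition] [cite: Springer1998, 12.1.1] -/
theorem finite_hodgeGroupCProdInl_or_eq_of_almostRatSimple
    (hQ' : ∀ N : Subgroup (SpecialLinearGroup ι₁ ℂ), IsZariskiClosed N → IsAutStable N → N ≤ hodgeGroupC Φ₁ →
      (∀ g ∈ hodgeGroupC Φ₁, ∀ x ∈ N, g * x * g⁻¹ ∈ N) → (N : Set (SpecialLinearGroup ι₁ ℂ)).Finite ∨ N = hodgeGroupC Φ₁) :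
    ((hodgeGroupCProdInl Φ₁ Φ₂ : Subgroup (SpecialLinearGroup ι₁ ℂ)) : Set (SpecialLinearGroup ι₁ ℂ)).Finite ∨
      hodgeGroupCProdInl Φ₁ Φ₂ = hodgeGroupC Φ₁ :=
  hQ' _ (isZariskiClosed_hodgeGroupCProdInl Φ₁ Φ₂) (isAutStable_hodgeGroupCProdInl Φ₁ Φ₂) (hodgeGroupCProdInl_le_hodgeGroupC Φ₁ Φ₂)
    fun _ hg _ hs ↦ conj_mem_hodgeGroupCProdInl Φ₁ Φ₂ hg hs

/-- **BOTH FACTORS WITH ALMOST `ℚ`-SIMPLE HODGE GROUPS (Moonen–Zarhin's use: `X₁`, `X₂` with `ℚ`-simple Hodge tori) AND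
`Hg(X₁ × X₂) ≠ Hg(X₁) × Hg(X₂)` ⟹ BOTH GOURSAT KERNELS ARE FINITE** («`𝔤₁ = 0 = 𝔤₃`»: `Hg(X₁ × X₂)(ℂ)⁰` is the graph of an
isogeny). [cite: MoonenZarhin1999LowDim, §3 Lemma (3.6), proof, and (3.1)] [cite: Gordon1997, §2.16 Proposition] -/
theorem finite_hodgeGroupCProdInl_and_finite_hodgeGroupCProdInr_of_ne_of_almostRatSimple
    (hQ'₁ : ∀ N : Subgroup (SpecialLinearGroup ι₁ ℂ), IsZariskiClosed N → IsAutStable N → N ≤ hodgeGroupC Φ₁ →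
      (∀ g ∈ hodgeGroupC Φ₁, ∀ x ∈ N, g * x * g⁻¹ ∈ N) → (N : Set (SpecialLinearGroup ι₁ ℂ)).Finite ∨ N = hodgeGroupC Φ₁)
    (hQ'₂ : ∀ N : Subgroup (SpecialLinearGroup ι₂ ℂ), IsZariskiClosed N → IsAutStable N → N ≤ hodgeGroupC Φ₂ →
      (∀ g ∈ hodgeGroupC Φ₂, ∀ x ∈ N, g * x * g⁻¹ ∈ N) → (N : Set (SpecialLinearGroup ι₂ ℂ)).Finite ∨ N = hodgeGroupC Φ₂)
    (hne : hodgeGroupC (prodPeriod Φ₁ Φ₂) ≠ blockDiagProd (hodgeGroupC Φ₁) (hodgeGroupC Φ₂)) :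
    ((hodgeGroupCProdInl Φ₁ Φ₂ : Subgroup (SpecialLinearGroup ι₁ ℂ)) : Set (SpecialLinearGroup ι₁ ℂ)).Finite ∧
      ((hodgeGroupCProdInr Φ₁ Φ₂ : Subgroup (SpecialLinearGroup ι₂ ℂ)) : Set (SpecialLinearGroup ι₂ ℂ)).Finite :=
  ⟨(finite_hodgeGroupCProdInl_or_eq_of_almostRatSimple Φ₁ Φ₂ hQ'₁).resolve_right fun h ↦
      hne (hodgeGroupC_prod_eq_blockDiagProd_of_hodgeGroupCProdInl_eq Φ₁ Φ₂ h),
    (finite_hodgeGroupCProdInr_or_eq_of_almostRatSimple Φ₁ Φ₂ hQ'₂).resolve_right fun h ↦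
      hne (hodgeGroupC_prod_eq_blockDiagProd_of_hodgeGroupCProdInr_eq Φ₁ Φ₂ h)⟩

/-- … hence, on rational Hodge Lie algebras, **`𝒜(X₁ × X₂) ≃ₗ⁅ℚ⁆ 𝒜(X₁)`, `𝒜(X₁ × X₂) ≃ₗ⁅ℚ⁆ 𝒜(X₂)` and `𝒜(X₁) ≃ₗ⁅ℚ⁆ 𝒜(X₂)`**
(«`𝔥𝔤(X) ≅ 𝔥𝔤(X₁)`, `𝔥𝔤(X₂) ≅ 𝔤₃ = 𝔥𝔤(X)`»; «`ℚ`-isogenous to `Hg(X₂)`», infinitesimally) — by p17's finite-kernel criterion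
`finite_hodgeGroupCProdInr_iff_nonempty_lieEquiv_hodgeGroupLieRat`. [cite: MoonenZarhin1999LowDim, §3 Lemma (3.6) and proof]
[cite: Gordon1997, §2.16 Proposition] -/
theorem nonempty_lieEquiv_hodgeGroupLieRat_prod_and_of_ne_of_almostRatSimple
    (hQ'₁ : ∀ N : Subgroup (SpecialLinearGroup ι₁ ℂ), IsZariskiClosed N → IsAutStable N → N ≤ hodgeGroupC Φ₁ →
      (∀ g ∈ hodgeGroupC Φ₁, ∀ x ∈ N, g * x * g⁻¹ ∈ N) → (N : Set (SpecialLinearGroup ι₁ ℂ)).Finite ∨ N = hodgeGroupC Φ₁)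
    (hQ'₂ : ∀ N : Subgroup (SpecialLinearGroup ι₂ ℂ), IsZariskiClosed N → IsAutStable N → N ≤ hodgeGroupC Φ₂ →
      (∀ g ∈ hodgeGroupC Φ₂, ∀ x ∈ N, g * x * g⁻¹ ∈ N) → (N : Set (SpecialLinearGroup ι₂ ℂ)).Finite ∨ N = hodgeGroupC Φ₂)
    (hne : hodgeGroupC (prodPeriod Φ₁ Φ₂) ≠ blockDiagProd (hodgeGroupC Φ₁) (hodgeGroupC Φ₂)) :
    Nonempty (hodgeGroupLieRat (prodPeriod Φ₁ Φ₂) ≃ₗ⁅ℚ⁆ hodgeGroupLieRat Φ₁) ∧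
      Nonempty (hodgeGroupLieRat (prodPeriod Φ₁ Φ₂) ≃ₗ⁅ℚ⁆ hodgeGroupLieRat Φ₂) ∧
        Nonempty (hodgeGroupLieRat Φ₁ ≃ₗ⁅ℚ⁆ hodgeGroupLieRat Φ₂) := by
  obtain ⟨h₁, h₂⟩ := finite_hodgeGroupCProdInl_and_finite_hodgeGroupCProdInr_of_ne_of_almostRatSimple Φ₁ Φ₂ hQ'₁ hQ'₂ hne
  obtain ⟨e₁⟩ := (finite_hodgeGroupCProdInr_iff_nonempty_lieEquiv_hodgeGroupLieRat Φ₁ Φ₂).1 h₂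
  obtain ⟨e₂⟩ := (finite_hodgeGroupCProdInl_iff_nonempty_lieEquiv_hodgeGroupLieRat Φ₁ Φ₂).1 h₁
  exact ⟨⟨e₁⟩, ⟨e₂⟩, ⟨e₁.symm.trans e₂⟩⟩

end Products

end ComplexTorus

end Literature.Geometry.Kaehler
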